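import Summits.Ventures.HSemireg.WedgeHankelRecurrenceGaussChebyshevPartialSums

/-!
# Venture HSemireg — **VAJDA'S IDENTITY FOR THE VIETA POLYNOMIALS IN EVERY COMMUTATIVE RING: `C_{a+2j} − C_a = (X² − 4)·S_{j−1}·S_{a+j−1}` and `C_m C_n − C_{m+j} C_{n−j} = −(X² − 4)·S_{j−1}·S_{m−n+j−1}`
# (all integers), `S_m S_{q+i+1} − S_{m+i+1} S_q = S_{m−q−1}·S_i` (`m ∈ ℤ`, `q, i ∈ ℕ`; i.e. `U_m U_n − U_{m+j} U_{n−j} = U_{j−1} U_{m−n+j−1}`)** — the common generalisation of Cassini, Catalan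
# and d'Ocagne (N544), from Mathlib `C_mul_C`, the chapter's `C_m S_k = S_{k+m} + S_{k−m}` (§1246) and the Clebsch–Gordan rule (N537)

HONEST FRAMING. Part of the Lean index of the computation cell `pub-hsemireg` (seat p10 gen 49, Sunday typer «UNIFORM-IN-n»).  Polynomial algebra over a commutative ring (Mathlib
`Polynomial.Chebyshev.S ∕ C`, `Finset.sum`); no variety, no cohomology theory, no sheaf, no Ext group and no semiregularity map is constructed here; nothing here says that HC / HC_CM / HC_AV holds;
no Literature fact (unproved `Prop`) is declared or used.  Custodian versions as in `WedgeHankelSiegelIdeal` (1/3).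
SOURCES (cited).  S. Vajda, *Fibonacci & Lucas Numbers, and the Golden Section* (Ellis Horwood 1989), identity (32) and its Lucas companion; T. Koshy, *Fibonacci and Lucas Numbers with Applications*
(Wiley 2001), Ch. 5 (Vajda ∕ Catalan ∕ d'Ocagne); J. C. Mason, D. C. Handscomb, *Chebyshev Polynomials* (2003), §2.4.3.
PROOF TYPED HERE.  (1) `(X² − 4)S_{j−1} = C_{j+1} − C_{j−1}` (N544 `chebyshevC_add_two_sub_C`), then `C_{j±1}·S_{a+j−1} = S_{a+2j} + S_{a−2}` resp. `S_{a+2j−2} + S_a` (§1246 `chebyshevC_mul_S`) and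
`C_k = S_k − S_{k−2}` (N535); (2) Mathlib `C_mul_C` twice; (3) Clebsch–Gordan (N537 `chebyshevS_mul_S`) for the three products and `Finset.sum_range_add` to split `Σ_{k≤q+i+1}` into the first `i+1`
and the last `q+1` terms.
DEDUP DISCLOSURE (`rg -n -i 'vajda|catalan|ocagne' Summits/Ventures/HSemireg` — only N544 (this chain), 2026-09-04): Cassini for `U ∕ T` (`WedgeHankelRecurrenceGaussChebyshevCassini`), d'Ocagne ∕ Catalan
(N544); the general Vajda identities are not typed; 0 hits for the 3 names below.

WHAT IS IN THE TREE.  N535 `chebyshevC_add_two_eq_S_sub_S`; N537 `chebyshevS_mul_S`; N544 `chebyshevC_add_two_sub_C`; §1246 `chebyshevC_mul_S`; Mathlib `C_mul_C`, `Finset.sum_range_add`.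
THIS FILE (namespace `Summit.Ventures.HSemireg.Wedge.HankelOuter` continued; CHAINED on N545; 0 definitions):
* §1311 **`chebyshevC_add_two_mul_sub_C`** (`C_{a+2j} − C_a = (X² − 4)S_{j−1}S_{a+j−1}`, all `a, j ∈ ℤ`), **`chebyshevC_vajda`** (`C_mC_n − C_{m+j}C_{n−j} = −(X² − 4)S_{j−1}S_{m−n+j−1}`, all integers),
  **`chebyshevS_vajda`** (`S_mS_{q+i+1} − S_{m+i+1}S_q = S_{m−q−1}S_i`, `m ∈ ℤ`, `q, i ∈ ℕ`).
CAVEATS.  The `S`-identity keeps two indices in `ℕ` (the Clebsch–Gordan rule is stated for `n ∈ ℕ`).  Nothing Ext-side.  New names only.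
-/

open Module Polynomial
open scoped Matrix Polynomial

namespace Summit.Ventures.HSemireg.Wedge.HankelOuter

/-! ## §1311. Vajda's identity -/

/-- **`C_{a+2j} − C_a = (X² − 4)·S_{j−1}·S_{a+j−1}`** for all `a, j ∈ ℤ`, in every commutative ring (`2cos(aθ) − 2cos((a+2j)θ) = 4 sin(jθ) sin((a+j)θ)`). [Vajda 1989; this file, §1311] -/
theorem chebyshevC_add_two_mul_sub_C (R : Type*) [CommRing R] (a j : ℤ) :
    Polynomial.Chebyshev.C R (a + 2 * j) - Polynomial.Chebyshev.C R a = (X ^ 2 - 4) * Polynomial.Chebyshev.S R (j - 1) * Polynomial.Chebyshev.S R (a + j - 1) := by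
  have h0 := chebyshevC_add_two_sub_C R (j - 1)
  rw [show j - 1 + 2 = j + 1 by ring] at h0
  have h1 := chebyshevC_mul_S (R := R) (j + 1) (a + j - 1)
  have h2 := chebyshevC_mul_S (R := R) (j - 1) (a + j - 1)
  rw [show a + j - 1 + (j + 1) = a + 2 * j by ring, show a + j - 1 - (j + 1) = a - 2 by ring] at h1
  rw [show a + j - 1 + (j - 1) = a + 2 * j - 2 by ring, show a + j - 1 - (j - 1) = a by ring] at h2
  have h3 := chebyshevC_add_two_eq_S_sub_S R (a + 2 * j - 2)
  have h4 := chebyshevC_add_two_eq_S_sub_S R (a - 2)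
  rw [show a + 2 * j - 2 + 2 = a + 2 * j by ring] at h3
  rw [show a - 2 + 2 = a by ring] at h4
  linear_combination h3 - h4 - h1 + h2 + Polynomial.Chebyshev.S R (a + j - 1) * h0

/-- **Vajda for `C`: `C_m·C_n − C_{m+j}·C_{n−j} = −(X² − 4)·S_{j−1}·S_{m−n+j−1}`** for all `m, n, j ∈ ℤ`. [Vajda 1989; this file, §1311] -/
theorem chebyshevC_vajda (R : Type*) [CommRing R] (m n j : ℤ) :
    Polynomial.Chebyshev.C R m * Polynomial.Chebyshev.C R n - Polynomial.Chebyshev.C R (m + j) * Polynomial.Chebyshev.C R (n - j) =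
      -((X ^ 2 - 4) * Polynomial.Chebyshev.S R (j - 1) * Polynomial.Chebyshev.S R (m - n + j - 1)) := by
  have h1 := Polynomial.Chebyshev.C_mul_C R m n
  have h2 := Polynomial.Chebyshev.C_mul_C R (m + j) (n - j)
  rw [show m + j + (n - j) = m + n by ring, show m + j - (n - j) = m - n + 2 * j by ring] at h2
  have h3 := chebyshevC_add_two_mul_sub_C R (m - n) j
  linear_combination h1 - h2 - h3

/-- **Vajda for `S`: `S_m·S_{q+i+1} − S_{m+i+1}·S_q = S_{m−q−1}·S_i`** for `m ∈ ℤ`, `q, i ∈ ℕ` (i.e. `U_mU_n − U_{m+j}U_{n−j} = U_{m−n+j−1}U_{j−1}` with `n = q + j`, `j = i + 1`). [Vajda 1989, (32); this file, §1311] -/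
theorem chebyshevS_vajda (R : Type*) [CommRing R] (m : ℤ) (q i : ℕ) :
    Polynomial.Chebyshev.S R m * Polynomial.Chebyshev.S R ((q + i + 1 : ℕ) : ℤ) - Polynomial.Chebyshev.S R (m + ((i + 1 : ℕ) : ℤ)) * Polynomial.Chebyshev.S R (q : ℤ) =
      Polynomial.Chebyshev.S R (m - (q : ℤ) - 1) * Polynomial.Chebyshev.S R (i : ℤ) := by
  rw [chebyshevS_mul_S, chebyshevS_mul_S, chebyshevS_mul_S, show q + i + 1 + 1 = (i + 1) + (q + 1) by ring, Finset.sum_range_add]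
  have e1 : ∑ k ∈ Finset.range (q + 1), Polynomial.Chebyshev.S R (m - ((q + i + 1 : ℕ) : ℤ) + 2 * (((i + 1) + k : ℕ) : ℤ)) =
      ∑ k ∈ Finset.range (q + 1), Polynomial.Chebyshev.S R (m + ((i + 1 : ℕ) : ℤ) - (q : ℤ) + 2 * (k : ℤ)) :=
    Finset.sum_congr rfl fun k _ => by congr 1; push_cast; ring
  have e2 : ∑ k ∈ Finset.range (i + 1), Polynomial.Chebyshev.S R (m - ((q + i + 1 : ℕ) : ℤ) + 2 * (k : ℤ)) =
      ∑ k ∈ Finset.range (i + 1), Polynomial.Chebyshev.S R (m - (q : ℤ) - 1 - (i : ℤ) + 2 * (k : ℤ)) :=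
    Finset.sum_congr rfl fun k _ => by congr 1; push_cast; ring
  rw [e1, e2]
  ring

end Summit.Ventures.HSemireg.Wedge.HankelOuter
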